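import Literature.Algebra.InverseSystem.AddInverseLimitExact
import Mathlib.Algebra.Module.CharacterModule
import HarnessLib

/-!
# The Pontryagin dual of an increasing union is the inverse limit of the duals

For an abelian group `G` exhausted by an increasing sequence of subgroups
`S 0 ≤ S 1 ≤ ⋯ ≤ G`, `⋃_m S m = G`, the character group `G⋆ = Hom(G, ℚ/ℤ)` (Mathlib's
`CharacterModule G`; Weibel, Def. 3.2.3 "Pontrjagin dual") is the inverse limit of the tower of
character groups `(S m)⋆` along the restriction maps (Weibel, Variation 2.6.9 / Thm. 2.6.10:
`Hom(colim_m S m, ℚ/ℤ) = lim_m Hom(S m, ℚ/ℤ)`), the inverse limit being the concrete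
`Literature.Algebra.InverseSystem.addInverseLimit` of `AddInverseLimit.lean` (for the tower
`G := fun m ↦ CharacterModule (S m)`, written `(G := …)` explicitly throughout since the family is not
inferred by unification):

* `charRestrict S hS m : CharacterModule (S (m+1)) →+ CharacterModule (S m)` — the transition maps
  (restriction along `S m ≤ S (m+1)`); they are SURJECTIVE (`charRestrict_surjective`: `ℚ/ℤ` is
  divisible, Weibel Cor. 2.3.3, Mathlib `CharacterModule.dual_surjective_of_injective`), so the dual
  tower is a surjective system and has `lim¹ = 0` in the concrete sense of the sibling file
  (`exists_sub_charRestrict_eq`, Weibel Lemma 3.5.3).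
* `toCharLimit S hS : CharacterModule G →+ lim_m CharacterModule (S m)` — the family of restrictions;
  injective when `⋃ S m = G` (`toCharLimit_injective`) and then also surjective
  (`toCharLimit_surjective`: a compatible family of characters glues to a character of the union — no
  divisibility needed), whence the isomorphism `charLimitEquiv S hS hU` with components the
  restrictions (`proj_charLimitEquiv_apply`).
* Compatibility over several steps (`proj_eq_restrict_proj_of_le`) and naturality in `G`
  (`toCharLimit_dual`: dualising a map of unions is the `addInverseLimit.map` of the levelwise duals).

All statements are proved; there are no named facts in this file.

## Why (where this is used)

Discrete Iwasawa-theoretic objects over a `ℤ_p`-tower `K_∞ = ⋃_n K_n` — e.g. a Selmer group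
`Sel(K_∞, E[p^∞]) = ⋃_{n,m} Sel_{p^m}(E/K_n)` (images of the finite levels) — have Pontryagin duals
`X = Hom(Sel(K_∞, E[p^∞]), ℚ/ℤ)` (the tree's `AcSigned.X`, `Kobayashi2003.SignedSelmerDualData`, …, all of
the form `_ →+ AddCircle (1 : ℚ)` = `CharacterModule _`). Printed sources read such an `X` as
`lim←` of the finite-level duals when passing finite-level duality statements (Poitou–Tate,
Cassels–Tate) to the limit (e.g. Castella–Wan 2024, (6.12)–(6.13); Greenberg, *Iwasawa theory for
elliptic curves*, §3). This file is the carrier-free algebra of that identification, companion to the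
exactness file `AddInverseLimitExact.lean`; it asserts nothing about any arithmetic object.

References: [Weibel1994] Def. 3.2.3, Cor. 2.3.3, Variation 2.6.9 / Thm. 2.6.10, Lemma 3.5.3;
[AtiyahMacdonald1969] Ch. 2, Ex. 2.14–2.19 (direct limits as unions, their morphisms), Ch. 10,
Prop. 10.2.
-/

namespace Literature.Algebra.InverseSystem

universe u

open Function

section DirectedUnion

variable {G : Type u} [AddCommGroup G] (S : ℕ → AddSubgroup G) (hS : ∀ m, S m ≤ S (m + 1))

/-- An increasing sequence of subgroups is monotone: `S m ≤ S m'` for `m ≤ m'`.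
[cite: AtiyahMacdonald1969, Ch. 2, Ex. 2.14 (directed systems)] -/
theorem le_of_le_succ_chain (hS : ∀ m, S m ≤ S (m + 1)) {m m' : ℕ} (h : m ≤ m') : S m ≤ S m' :=
  monotone_nat_of_le_succ hS h

/-- **The transition maps of the dual tower**: restriction of characters along `S m ≤ S (m+1)`,
`(S (m+1))⋆ → (S m)⋆` (Mathlib `CharacterModule.dual` of the inclusion, as an additive map).
[cite: Weibel1994, Def. 3.2.3 (Pontrjagin dual) and Variation 2.6.9] -/
def charRestrict (m : ℕ) : CharacterModule (S (m + 1)) →+ CharacterModule (S m) :=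
  (CharacterModule.dual ((AddSubgroup.inclusion (hS m)).toIntLinearMap)).toAddMonoidHom

/-- `charRestrict` is precomposition with the inclusion (unfolding, by `rfl`).
[cite: Weibel1994, Def. 3.2.3] -/
@[simp]
theorem charRestrict_apply (m : ℕ) (χ : CharacterModule (S (m + 1))) (x : S m) :
    charRestrict S hS m χ x = χ (AddSubgroup.inclusion (hS m) x) := rfl

/-- **The restriction maps of the dual tower are surjective** (`ℚ/ℤ` is divisible, hence injective:
every character of `S m` extends to `S (m+1)`; Mathlib `CharacterModule.dual_surjective_of_injective`).
So the dual tower of an increasing union is a SURJECTIVE system. [cite: Weibel1994, Cor. 2.3.3 and Lemma 3.5.3] -/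
theorem charRestrict_surjective (m : ℕ) : Surjective (charRestrict S hS m) :=
  CharacterModule.dual_surjective_of_injective _ (AddSubgroup.inclusion_injective (hS m))

/-- **`lim¹` of the dual tower vanishes** (concrete form): every family `d_m ∈ (S m)⋆` is
`k_m - (k_{m+1})|_{S m}` for some family `k` (surjective transitions,
`exists_sub_transition_eq_of_surjective`). [cite: Weibel1994, Lemma 3.5.3] -/
theorem exists_sub_charRestrict_eq (d : ∀ m, CharacterModule (S m)) :
    ∃ k : ∀ m, CharacterModule (S m), ∀ m, k m - charRestrict S hS m (k (m + 1)) = d m :=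
  exists_sub_transition_eq_of_surjective (K := fun m ↦ CharacterModule (S m)) _
    (charRestrict_surjective S hS) d

/-- **`G⋆ → lim_m (S m)⋆`**, the family of restrictions of a character of `G` to the subgroups `S m`
(compatible with the transition maps by construction; `addInverseLimit.lift`).
[cite: Weibel1994, Variation 2.6.9 / Thm. 2.6.10 (`Hom(colim A_i, B) = lim Hom(A_i, B)`)] -/
def toCharLimit :
    CharacterModule G →+ addInverseLimit (G := fun m ↦ CharacterModule (S m)) (charRestrict S hS) :=
  addInverseLimit.lift (G := fun m ↦ CharacterModule (S m)) (charRestrict S hS)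
    (fun m ↦ (CharacterModule.dual ((S m).subtype.toIntLinearMap)).toAddMonoidHom) fun _ _ ↦ rfl

/-- Components of `toCharLimit`: the `m`-th projection is restriction to `S m` (by `rfl`).
[cite: Weibel1994, Variation 2.6.9] -/
@[simp]
theorem proj_toCharLimit_apply (m : ℕ) (χ : CharacterModule G) (x : S m) :
    addInverseLimit.proj (G := fun m ↦ CharacterModule (S m)) (charRestrict S hS) m
      (toCharLimit S hS χ) x = χ (x : G) := rfl

/-- **Multi-step compatibility** in the dual tower: for `m ≤ m'`, the `m`-th component of a
compatible family is the restriction of the `m'`-th component along `S m ≤ S m'` (induction on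
`m' - m` from the one-step compatibility). [cite: AtiyahMacdonald1969, Ch. 10, p. 103 (coherent sequences)] -/
theorem proj_eq_restrict_proj_of_le
    (x : addInverseLimit (G := fun m ↦ CharacterModule (S m)) (charRestrict S hS)) {m m' : ℕ}
    (h : m ≤ m') (g : S m) :
    addInverseLimit.proj (G := fun m ↦ CharacterModule (S m)) (charRestrict S hS) m x g =
      addInverseLimit.proj (G := fun m ↦ CharacterModule (S m)) (charRestrict S hS) m' x
        (AddSubgroup.inclusion (le_of_le_succ_chain S hS h) g) := by
  induction h with
  | refl => rfl
  | @step m' h ih =>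
    rw [ih, ← addInverseLimit.transition_proj_succ (G := fun m ↦ CharacterModule (S m))
      (charRestrict S hS) m', charRestrict_apply]
    rfl

/-- **`G⋆ → lim (S m)⋆` is injective when `G = ⋃ S m`**: a character vanishing on every `S m`
vanishes. [cite: Weibel1994, Variation 2.6.9 / Thm. 2.6.10] -/
theorem toCharLimit_injective (hU : ∀ g : G, ∃ m, g ∈ S m) : Injective (toCharLimit S hS) := by
  intro χ ψ h
  refine CharacterModule.ext _ fun g ↦ ?_
  obtain ⟨m, hm⟩ := hU g
  have := congrArg (fun y ↦
    addInverseLimit.proj (G := fun m ↦ CharacterModule (S m)) (charRestrict S hS) m y ⟨g, hm⟩) h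
  exact this

/-- **`G⋆ → lim (S m)⋆` is surjective when `G = ⋃ S m`**: a compatible family of characters
`χ_m : S m → ℚ/ℤ` glues to the character `g ↦ χ_m(g)` (`m` any index with `g ∈ S m`; independent of
`m` by `proj_eq_restrict_proj_of_le`; additive because `g, h, g + h` lie in a common `S m`). No
divisibility of `ℚ/ℤ` is used here. [cite: Weibel1994, Variation 2.6.9 / Thm. 2.6.10 (`Hom(colim A_i, B) = lim Hom(A_i, B)`)]
[cite: AtiyahMacdonald1969, Ch. 2, Ex. 2.16 (universal property of the direct limit)] -/
theorem toCharLimit_surjective (hU : ∀ g : G, ∃ m, g ∈ S m) : Surjective (toCharLimit S hS) := by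
  intro x
  -- index of a subgroup containing `g`, and the glued value
  let ι : G → ℕ := fun g ↦ Classical.choose (hU g)
  have hι : ∀ g, g ∈ S (ι g) := fun g ↦ Classical.choose_spec (hU g)
  let χ : G → AddCircle (1 : ℚ) := fun g ↦
    addInverseLimit.proj (G := fun m ↦ CharacterModule (S m)) (charRestrict S hS) (ι g) x ⟨g, hι g⟩
  -- independence of the index
  have hval : ∀ (g : G) (m : ℕ) (hm : g ∈ S m),
      χ g = addInverseLimit.proj (G := fun m ↦ CharacterModule (S m)) (charRestrict S hS) m x
        ⟨g, hm⟩ := by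
    intro g m hm
    -- compare both with the level `max (ι g) m`
    have h1 := proj_eq_restrict_proj_of_le S hS x (le_max_left (ι g) m) ⟨g, hι g⟩
    have h2 := proj_eq_restrict_proj_of_le S hS x (le_max_right (ι g) m) ⟨g, hm⟩
    change addInverseLimit.proj (G := fun m ↦ CharacterModule (S m)) (charRestrict S hS) (ι g) x
      ⟨g, hι g⟩ = _
    rw [h1, h2]
    rfl
  refine ⟨{ toFun := χ, map_zero' := ?_, map_add' := fun g h ↦ ?_ }, ?_⟩
  · rw [hval 0 0 (zero_mem _)]
    exact map_zero _
  · -- `g`, `h`, `g + h` all lie in `S M` for `M` large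
    obtain ⟨M, hg, hh⟩ : ∃ M, g ∈ S M ∧ h ∈ S M :=
      ⟨max (ι g) (ι h), le_of_le_succ_chain S hS (le_max_left _ _) (hι g),
        le_of_le_succ_chain S hS (le_max_right _ _) (hι h)⟩
    rw [hval g M hg, hval h M hh, hval (g + h) M (add_mem hg hh), ← map_add]
    rfl
  · refine addInverseLimit.ext fun m ↦ CharacterModule.ext _ fun g ↦ ?_
    rw [proj_toCharLimit_apply]
    exact hval (g : G) m g.2

/-- **`G⋆ ≅ lim_m (S m)⋆` for `G = ⋃_m S m`**: the Pontryagin dual of an increasing union is the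
inverse limit of the duals along the restriction maps. [cite: Weibel1994, Variation 2.6.9 / Thm. 2.6.10 and Def. 3.2.3] -/
noncomputable def charLimitEquiv (hU : ∀ g : G, ∃ m, g ∈ S m) :
    CharacterModule G ≃+ addInverseLimit (G := fun m ↦ CharacterModule (S m)) (charRestrict S hS) :=
  AddEquiv.ofBijective (toCharLimit S hS)
    ⟨toCharLimit_injective S hS hU, toCharLimit_surjective S hS hU⟩

/-- Components of `charLimitEquiv`: restriction to `S m` (by `rfl`). [cite: Weibel1994, Variation 2.6.9] -/
@[simp]
theorem proj_charLimitEquiv_apply (hU : ∀ g : G, ∃ m, g ∈ S m) (m : ℕ) (χ : CharacterModule G)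
    (x : S m) :
    addInverseLimit.proj (G := fun m ↦ CharacterModule (S m)) (charRestrict S hS) m
      (charLimitEquiv S hS hU χ) x = χ (x : G) := rfl

include hS in
/-- A character of `G = ⋃ S m` is determined by its restrictions: `χ = ψ` as soon as
`χ|_{S m} = ψ|_{S m}` for all `m`. [cite: Weibel1994, Variation 2.6.9] -/
theorem characterModule_ext_of_iUnion (hU : ∀ g : G, ∃ m, g ∈ S m) {χ ψ : CharacterModule G}
    (h : ∀ (m : ℕ) (x : S m), χ (x : G) = ψ (x : G)) : χ = ψ :=
  toCharLimit_injective S hS hU (addInverseLimit.ext fun m ↦ CharacterModule.ext _ fun x ↦ h m x)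

end DirectedUnion

/-! ### Functoriality: duals of compatible maps of increasing unions -/

section Functorial

variable {G : Type u} [AddCommGroup G] {S : ℕ → AddSubgroup G} {hS : ∀ m, S m ≤ S (m + 1)}
  {G' : Type u} [AddCommGroup G'] {S' : ℕ → AddSubgroup G'} {hS' : ∀ m, S' m ≤ S' (m + 1)}
  (φ : G →+ G') (hφ : ∀ m, ∀ g ∈ S m, φ g ∈ S' m)

/-- The levelwise maps `S m → S' m` of a homomorphism `φ : G → G'` carrying `S m` into `S' m`.
[cite: AtiyahMacdonald1969, Ch. 2, Ex. 2.18 (homomorphisms of direct systems)] -/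
def levelMap (m : ℕ) : S m →+ S' m :=
  (φ.comp (S m).subtype).codRestrict (S' m) fun g ↦ hφ m g g.2

/-- Components of `levelMap` (by `rfl`). [cite: AtiyahMacdonald1969, Ch. 2, Ex. 2.18] -/
@[simp]
theorem coe_levelMap_apply (m : ℕ) (g : S m) : (levelMap φ hφ m g : G') = φ g := rfl

/-- The levelwise DUAL maps `(S' m)⋆ → (S m)⋆` of `φ` commute with the restriction maps (a map of
inverse systems). [cite: AtiyahMacdonald1969, Ch. 10, p. 104 (homomorphisms of inverse systems)] -/
theorem charRestrict_dual_levelMap (hS : ∀ m, S m ≤ S (m + 1)) (hS' : ∀ m, S' m ≤ S' (m + 1))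
    (m : ℕ) (χ : CharacterModule (S' (m + 1))) :
    charRestrict S hS m
        ((CharacterModule.dual (levelMap φ hφ (m + 1)).toIntLinearMap).toAddMonoidHom χ) =
      (CharacterModule.dual (levelMap φ hφ m).toIntLinearMap).toAddMonoidHom
        (charRestrict S' hS' m χ) := by
  refine CharacterModule.ext _ fun x ↦ ?_
  rfl

/-- **Naturality**: dualising `φ : G → G'` and then passing to the limit of restrictions equals passing
to the limit and applying the map of inverse limits induced by the levelwise duals
(`addInverseLimit.map`). [cite: Weibel1994, Variation 2.6.9 / Thm. 2.6.10 (naturality of `Hom(colim A_i, B) = lim Hom(A_i, B)`)] -/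
theorem toCharLimit_dual (hS : ∀ m, S m ≤ S (m + 1)) (hS' : ∀ m, S' m ≤ S' (m + 1))
    (χ : CharacterModule G') :
    toCharLimit S hS ((CharacterModule.dual φ.toIntLinearMap).toAddMonoidHom χ) =
      addInverseLimit.map (G := fun m ↦ CharacterModule (S' m)) (G' := fun m ↦ CharacterModule (S m))
        (charRestrict S' hS') (charRestrict S hS)
        (fun m ↦ (CharacterModule.dual (levelMap φ hφ m).toIntLinearMap).toAddMonoidHom)
        (charRestrict_dual_levelMap φ hφ hS hS') (toCharLimit S' hS' χ) := by
  refine addInverseLimit.ext fun m ↦ CharacterModule.ext _ fun x ↦ ?_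
  rfl

end Functorial

end Literature.Algebra.InverseSystem
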